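import Mathlib
import Summits.ValiantsHypothesis.ValiantsHypothesis.Theorems.NewtonUnitEquationsDissociatedUniformTotalsLaw
import Summits.ValiantsHypothesis.ValiantsHypothesis.Theorems.NewtonUnitEquationsDissociatedUniformTotalsLawHodographFamilies
import Summits.ValiantsHypothesis.ValiantsHypothesis.Theorems.NewtonUnitEquationsDissociatedUniformTotalsLawHodographRelabel
import Summits.ValiantsHypothesis.ValiantsHypothesis.Theorems.NewtonUnitEquationsDissociatedUniformTotalsLawMultipliers
import Summits.ValiantsHypothesis.ValiantsHypothesis.Theorems.NewtonUnitEquationsDissociatedUniformTotalsLawMultiplierParabola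
import Summits.ValiantsHypothesis.ValiantsHypothesis.Theorems.NewtonUnitEquationsDissociatedUniformTotalsLawCircles
import HarnessLib

/-!
# Crux `NewtonUnitEquations.DissociatedUniform` (stmt-ValiantsHypothesis-5905), `n = 3` totals law of model (Q**):
# the MIXED kit-census families of NOTES-d1g3 §3 by name

The structured `n = 3` scans of kit j298398 (NOTES-d1g3 §3: "parabola pairs × circle / polynomial `c₃` with multipliers", 1484 families per
`q ≤ 31`, `max T/q² = 2.00`) combine two census parabolas `(Pᵢk, Qᵢk²)` (natural labels) with a third curve that is a sampled circle or a
parabola read with a multiplier `u`.  All of them are instances of the crossing-number form of the hodograph-convex totals law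
(`…HodographRelabel.totalVert_le_of_fewCrossings`) with `K = 2` for the parabolas (`convexlyOrdered_edgeVec_parabola`) and
`K = 2·min(u.val, q − u.val)` for the multiplier curve (`fewCrossings_edgeVec_comp_unitMul` with `convexlyOrdered_chordVec_trigCurve_unit` /
`convexlyOrdered_chordVec_parabola_unit`):
* `totalVert_parabolas_circleMultiplier_le`: `T ≤ (4 + 2·min(m, q−m))·q² + 6Z` for parabola, parabola, circle(m);
* `totalVert_parabola_circle_circleMultiplier_le`: parabola, circle, circle(m);
* `totalVert_parabolas_circle_le`: parabola, parabola, circle (natural labels): `T ≤ 6q² + 6Z`.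
`Z` = number of collinear edge-vector triples (`0` in general position).  `TotalsLawThree C` for arbitrary labellings remains OPEN; VP ≠ VNP is
not touched.
[folklore: instances of the landed crossing-number theorem]
-/

set_option linter.dupNamespace false -- `ValiantsHypothesis.ValiantsHypothesis` (summit = problem) in every name

open scoped BigOperators Pointwise

namespace Summit.ValiantsHypothesis.ValiantsHypothesis.Theorems.NewtonUnitEquationsDissociatedUniform

namespace TotalsLaw

section CensusFamilies

variable {q : ℕ} [NeZero q]

/-- The census parabola with natural labels. -/
noncomputable def censusParabola (P Q : ℝ) (z : ZMod q) : Fin 2 → ℝ := ![P * (z.val : ℝ), Q * (z.val : ℝ) ^ 2]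

/-- Its hodograph has crossing number `≤ 2`. [folklore] -/
theorem fewCrossings_edgeVec_censusParabola (P Q : ℝ) : FewCrossings (edgeVec (censusParabola (q := q) P Q)) 2 :=
  (convexlyOrdered_edgeVec_parabola (q := q) P Q).fewCrossings

/-- A sampled circle read with a unit multiplier has hodograph crossing number `≤ 2·min(u.val, q − u.val)`. [folklore] -/
theorem fewCrossings_edgeVec_trigCurve_multiplier (c₀ : Fin 2 → ℝ) (A φ : ℝ) (u : (ZMod q)ˣ) :
    FewCrossings (edgeVec fun k => trigCurve (q := q) c₀ A φ ((u : ZMod q) * k)) (2 * min (u : ZMod q).val (q - (u : ZMod q).val)) :=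
  fewCrossings_edgeVec_comp_unitMul _ u (convexlyOrdered_chordVec_trigCurve_unit c₀ A φ u)

/-- A sampled circle with natural labels has hodograph crossing number `≤ 2`. [folklore] -/
theorem fewCrossings_edgeVec_trigCurve (c₀ : Fin 2 → ℝ) (A φ : ℝ) : FewCrossings (edgeVec (trigCurve (q := q) c₀ A φ)) 2 :=
  (convexlyOrdered_edgeVec_trigCurve (q := q) c₀ A φ).fewCrossings

/-- **Kit family "parabola pair × circle(m)"**: `T ≤ (2 + 2 + 2·min(m, q−m))·q² + 6Z`. [folklore] -/
theorem totalVert_parabolas_circleMultiplier_le (P₁ Q₁ P₂ Q₂ : ℝ) (c₀ : Fin 2 → ℝ) (A φ : ℝ) (u : (ZMod q)ˣ) :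
    totalVert (censusParabola (q := q) P₁ Q₁) (censusParabola P₂ Q₂) (fun k => trigCurve c₀ A φ ((u : ZMod q) * k)) ≤
      (2 + 2 + 2 * min (u : ZMod q).val (q - (u : ZMod q).val)) * q ^ 2 +
        6 * zeroCount (censusParabola (q := q) P₁ Q₁) (censusParabola P₂ Q₂) (fun k => trigCurve c₀ A φ ((u : ZMod q) * k)) :=
  totalVert_le_of_fewCrossings _ _ _ (fewCrossings_edgeVec_censusParabola P₁ Q₁) (fewCrossings_edgeVec_censusParabola P₂ Q₂)
    (fewCrossings_edgeVec_trigCurve_multiplier c₀ A φ u)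

/-- **Kit family "parabola × circle × circle(m)"**: `T ≤ (2 + 2 + 2·min(m, q−m))·q² + 6Z`. [folklore] -/
theorem totalVert_parabola_circle_circleMultiplier_le (P Q : ℝ) (c₁ : Fin 2 → ℝ) (A₁ φ₁ : ℝ) (c₂ : Fin 2 → ℝ) (A₂ φ₂ : ℝ)
    (u : (ZMod q)ˣ) :
    totalVert (censusParabola (q := q) P Q) (trigCurve c₁ A₁ φ₁) (fun k => trigCurve c₂ A₂ φ₂ ((u : ZMod q) * k)) ≤
      (2 + 2 + 2 * min (u : ZMod q).val (q - (u : ZMod q).val)) * q ^ 2 +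
        6 * zeroCount (censusParabola (q := q) P Q) (trigCurve c₁ A₁ φ₁) (fun k => trigCurve c₂ A₂ φ₂ ((u : ZMod q) * k)) :=
  totalVert_le_of_fewCrossings _ _ _ (fewCrossings_edgeVec_censusParabola P Q) (fewCrossings_edgeVec_trigCurve c₁ A₁ φ₁)
    (fewCrossings_edgeVec_trigCurve_multiplier c₂ A₂ φ₂ u)

/-- **Family "parabola pair × circle"** (natural labels): `T ≤ 6q² + 6Z`. [folklore] -/
theorem totalVert_parabolas_circle_le (P₁ Q₁ P₂ Q₂ : ℝ) (c₀ : Fin 2 → ℝ) (A φ : ℝ) :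
    totalVert (censusParabola (q := q) P₁ Q₁) (censusParabola P₂ Q₂) (trigCurve c₀ A φ) ≤
      6 * q ^ 2 + 6 * zeroCount (censusParabola (q := q) P₁ Q₁) (censusParabola P₂ Q₂) (trigCurve c₀ A φ) := by
  have h := totalVert_le_of_fewCrossings _ _ _ (fewCrossings_edgeVec_censusParabola (q := q) P₁ Q₁)
    (fewCrossings_edgeVec_censusParabola P₂ Q₂) (fewCrossings_edgeVec_trigCurve c₀ A φ)
  simpa using h

end CensusFamilies

end TotalsLaw

end Summit.ValiantsHypothesis.ValiantsHypothesis.Theorems.NewtonUnitEquationsDissociatedUniform
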